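import Summits.HodgeConjecture.CorCM.Census.PairFlipSexticFourCorePowers
import Summits.HodgeConjecture.CorCM.DihedralSexticPairCurvePowersTransfer
import HarnessLib

/-!
# COR-CM — the four CM threefolds of a PAIR-FLIP sextic CM field: the Hodge conjecture for ALL products of powers
# `X₀^a × X₁^b × X₂^c × X₃^d` follows from the algebraicity of the ONE face species of `X₀ × X₁ × X₂ × X₃`
# (frame transfer, generating parts, assembly — frame form)

Cell `pub-hodgecm2` (COR-CM), binder seat b25 (gen 37); COUNT-NEUTRAL own lane (work item W-b of the lead's B01-SIZE
§4 T2); theorems only plus ONE auxiliary definition (the model map `toPt`); no named fact, no `sorry`.  This is the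
geometric half of `Census/PairFlipSexticFourCore.lean` + `Census/PairFlipSexticFourCorePowers.lean` (the 24-point
model of `Q = X₀ × X₁ × X₂ × X₃`, generating weights = 12 conjugate pairs + 6 faces, and the induction principle for
balanced configurations of any power), written VERBATIM on the pattern of b30's
`CorCM/DihedralSexticPairCurveTransfer.lean` / `…PowersTransfer.lean` and consuming by name b30's distribution lemma
(`CMWeights.weightClassesAlg_comp_le_algebraicClasses_of_injOn`), the multiplicativity of algebraic weight lines
(`PairWeights.weightClassesAlg_union_le_algebraicClasses`), the divisor lemma for conjugation-stable weights
(`PairWeights.weightClassesAlg_le_algebraicClasses_of_conj_smul_mem`), the counting lemma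
`DihedralSexticPairCurvePowers.ncard_sep_eq_card_filter`, Pohlmann's theorem for CM algebras
(`Pohlmann1968_thm1_cmAlgebra`, Gao–Ullmo 2025 Thm 3.1) and the domination descent
(`Domination.hodgeConjectureFor_of_avDominatedBy`).

SETTING (frame form).  `K` a CM field read in a FRAME `e : Hom(K, ℂ) ≃ ℤ/3 × Bool` such that complex conjugation flips
the sign (`he_conj`) and every map `act j false fl` of `(ℤ/2)³ ⋊ C₃` — rotate the places by `j`, then flip the signs at
the places marked by `fl` — is REALISED by an automorphism of `ℂ` (`he_gal`); this is exactly the pair-flip / closure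
24–48 situation (for a closure-48 field the reflections are realised too, but they are not needed).  Four CM types
`Φ₄ b` (`b : Fin 4`) read in the frame by the model type `phi` (`hΦ`: `Φ₄ 0 = (+,+,+)`, `Φ₄ b` flipped at place
`b − 1`), and realisations `A₄ b ⊨ (K; Φ₄ b)` on `H¹` (`IsCMTypeRealisation`) — the four simple CM threefolds
`X₀, …, X₃`.  A slot map `κ : Fin N → Fin 4` gives the power `X = ⨁_j A₄ (κ j)` (any number of copies of each).

* §1 `modelBalanced_of_isGaloisBalancedAlg` — FRAME TRANSFER: an `Aut(ℂ)`-balanced weight of `X` (Pohlmann's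
  condition for the CM algebra `K^N` with types `Φ₄ ∘ κ`) is a balanced configuration of the 24-point model under
  `v = toPt e ∘ P`, `P (j, s) = (κ j, s)` [cite: GaoUllmo2025, Thm 3.1 (3.2)].
* §2 `exists_weightClassesAlg_le_algebraicClasses_of_part` — a part `G` of a weight of `X` on which `v` is injective and
  whose image is a generating weight has an algebraic weight line: conjugate pairs give divisor classes, faces are the
  hypothesis `hface` on `Y = ⨁ A₄`, and the distribution lemma lifts from `Y` to `X`.
* §3 **`hodgeConjectureFor_biproduct_comp_of_faces`** — `HodgeConjectureFor (⨁_j A₄ (κ j))` for EVERY `κ`, GIVEN ONLY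
  the frame data and `hface` (the weight lines of the six face weights of `Y` are algebraic); and the `AVDominatedBy`
  form **`hodgeConjectureFor_of_avDominatedBy_comp_of_faces`** (every abelian variety dominated by such a power — in
  particular every abelian variety isogenous to a product of powers of `X₀, …, X₃`).
So, for the stage-1 field class: **the Hodge conjecture for every abelian variety with complex multiplication through
`K` (isogenous to a product of powers of the four CM threefolds of `K`) is reduced to ONE statement — the algebraicity
of the face class of the 12-fold `X₀ × X₁ × X₂ × X₃`** (six weights, one Galois orbit, `Census/PairFlipSexticFourCore
.face_orbit`).  That face class is the rank-four face class which a period statement of PerL type for `K` (T2, with the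
non-Galois surface criterion W-a) would make algebraic; nothing here uses or proves `PerL`, `PerLFace` or `HC_CM`.
HONEST FRAMING: conditional on `hface`; no case of the Hodge conjecture is proved unconditionally here; `HC_CM` is NOT
asserted.  The intrinsic form (constructing the frame `e` and `he_gal` from `[L:ℚ] ∈ {24, 48}` with p2's
`CorCM/SexticCMFieldPairFlip.lean`) is left to a sequel.
[cite: Pohlmann1968, Thm 1] [cite: GaoUllmo2025, Thm 3.1] [cite: Milne2020HodgeClassesAV, 1.2 (a) and Thm. 1]
[cite: MumfordAV1970, §19]

## References
* [Pohlmann1968] H. Pohlmann, Ann. of Math. 88 (1968), Thm 1.  [GaoUllmo2025] Z. Gao, E. Ullmo, J. Inst. Math. Jussieu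
  25 (2025), Thm 3.1.  [Milne2020HodgeClassesAV] J. S. Milne, arXiv:2010.08857, 1.2 (a), Thm. 1.  [MumfordAV1970] §19.
  [Gordon1999HodgeAVSurvey] B. B. Gordon, §9.2.  [VoisinHodgeII2003] C. Voisin, Prop. 9.20.
-/

noncomputable section

open CategoryTheory CategoryTheory.Limits NumberField

namespace Summit.HodgeConjecture.CorCM.PairFlipSexticFourCore

open Literature.AlgebraicGeometry Literature.AlgebraicGeometry.Motives Literature.AlgebraicGeometry.HodgeTheory
open Literature.AlgebraicGeometry.ComplexMultiplication (IsCMTypeRealisation)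
open Literature.AlgebraicGeometry.Pohlmann1968
open Literature.AlgebraicTopology.SingularHomology
open Literature.NumberTheory.ComplexMultiplication
open Summit.HodgeConjecture.CorCM.CMWeights (conj_smul_sigma_eq smul_sigma_eq
  weightClassesAlg_comp_le_algebraicClasses_of_injOn)
open Summit.HodgeConjecture.CorCM.PairWeights (weightClassesAlg_union_le_algebraicClasses
  weightClassesAlg_le_algebraicClasses_of_conj_smul_mem)
open Summit.HodgeConjecture.CorCM.Census.PairFlipSexticFourCore (Pt act phi conjPair face gens flipAt act_apply act_conj
  mem_gens_iff mem_conjPair_iff mem_face_iff gens_balanced isCMType_phi)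
open Summit.HodgeConjecture.CorCM.Census.PairFlipSexticFourCorePowers (ModelBalanced modelBalanced_induction)
open Summit.HodgeConjecture.CorCM.DihedralSexticPairCurvePowers (ncard_sep_eq_card_filter)

open scoped Classical Pointwise

/-! ## §0 The model map -/

section Defs

variable {K : Type} [Field K]

/-- **The model map** `Hom(K⁴, ℂ) = ⊔₄ Hom(K, ℂ) → Pt`: `(b, s) ↦ (b, e s)` (factor, place, sign). [folklore] -/
def toPt (e : (K →+* ℂ) ≃ ZMod 3 × Bool) : ((_ : Fin 4) × (K →+* ℂ)) → Pt := fun x => (x.1, (e x.2).1, (e x.2).2)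

/-- Unfolding of `toPt`. [folklore] -/
@[simp] theorem toPt_mk (e : (K →+* ℂ) ≃ ZMod 3 × Bool) (b : Fin 4) (s : K →+* ℂ) :
    toPt e ⟨b, s⟩ = (b, (e s).1, (e s).2) := rfl

/-- The model map is injective (the frame is a bijection). [folklore] -/
theorem toPt_injective (e : (K →+* ℂ) ≃ ZMod 3 × Bool) : Function.Injective (toPt e) := by
  rintro ⟨b, s⟩ ⟨b', s'⟩ h
  simp only [toPt_mk, Prod.mk.injEq] at h
  obtain ⟨rfl, h1, h2⟩ := h
  have hs : s = s' := e.injective (Prod.ext h1 h2)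
  subst hs
  rfl

/-- `act j false fl` on a model point: rotate the place by `j`, flip the sign at the marked places. [folklore] -/
theorem act_false_apply (j : ZMod 3) (fl : Bool × Bool × Bool) (b : Fin 4) (i : ZMod 3) (s : Bool) :
    act j false fl (b, i, s) = (b, i + j, xor s (flipAt fl (i + j))) := by
  rw [act_apply]
  simp

end Defs

/-! ## §1 Frame transfer -/

section Transfer

variable {K : Type} [Field K] {N : ℕ} (κ : Fin N → Fin 4) {e : (K →+* ℂ) ≃ ZMod 3 × Bool}
  (he_conj : ∀ s : K →+* ℂ, e (ComplexEmbedding.conjugate s) = ((e s).1, !(e s).2))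
  (he_gal : ∀ (j : ZMod 3) (fl : Bool × Bool × Bool), ∃ σ : ℂ ≃+* ℂ, ∀ s : K →+* ℂ,
    e ((σ : ℂ →+* ℂ).comp s) = ((e s).1 + j, xor (e s).2 (flipAt fl ((e s).1 + j))))
  {Φ₄ : Fin 4 → CMType K}
  (hΦ : ∀ (b : Fin 4) (s : K →+* ℂ), s ∈ (Φ₄ b).1 ↔ ((b, (e s).1, (e s).2) : Pt) ∈ phi)

include hΦ in
/-- **Membership read in the frame**: if `σ ∈ Aut(ℂ)` realises the model map `act j false fl` on `Hom(K, ℂ)`, then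
`σ ∘ x ∈ Φ₄ (κ x.1) ↔ act j false fl (toPt (P x)) ∈ phi`. [cite: GaoUllmo2025, Thm 3.1 (3.2)] -/
theorem comp_mem_iff_act_mem_phi {σ : ℂ ≃+* ℂ} {j : ZMod 3} {fl : Bool × Bool × Bool}
    (hσ : ∀ s : K →+* ℂ, e ((σ : ℂ →+* ℂ).comp s) = ((e s).1 + j, xor (e s).2 (flipAt fl ((e s).1 + j))))
    (x : (_ : Fin N) × (K →+* ℂ)) :
    (σ : ℂ →+* ℂ).comp x.2 ∈ (Φ₄ (κ x.1)).1 ↔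
      act j false fl (toPt e ((Sigma.map κ (fun _ => id) :
        ((_ : Fin N) × (K →+* ℂ)) → ((_ : Fin 4) × (K →+* ℂ))) x)) ∈ phi := by
  obtain ⟨j', s⟩ := x
  rw [hΦ, hσ]
  show _ ↔ act j false fl (toPt e ⟨κ j', s⟩) ∈ phi
  rw [toPt_mk, act_false_apply]

include he_gal hΦ in
/-- **FRAME TRANSFER FOR THE POWERS**: an `Aut(ℂ)`-balanced weight of `X = ⨁_j A₄ (κ j)` (`IsGaloisBalancedAlg` for
the CM algebra `K^N`, types `Φ₄ (κ j)`) is a balanced configuration of the 24-point model under `v = toPt e ∘ P`,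
`P (j, s) = (κ j, s)` (the 24 maps `act j false fl` are realised by automorphisms of `ℂ`).
[cite: GaoUllmo2025, Thm 3.1 (3.2)] -/
theorem modelBalanced_of_isGaloisBalancedAlg {S : Finset ((_ : Fin N) × (K →+* ℂ))}
    (hS : IsGaloisBalancedAlg (K := fun _ : Fin N => K) (fun j => Φ₄ (κ j)) S) :
    ModelBalanced (fun x => toPt e ((Sigma.map κ (fun _ => id) :
      ((_ : Fin N) × (K →+* ℂ)) → ((_ : Fin 4) × (K →+* ℂ))) x)) S := by
  intro j fl
  obtain ⟨σ, hσ⟩ := he_gal j fl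
  have h := hS σ
  rw [ncard_sep_eq_card_filter, ncard_sep_eq_card_filter] at h
  have key : ∀ x : (_ : Fin N) × (K →+* ℂ),
      (σ : ℂ →+* ℂ).comp x.2 ∈ (Φ₄ (κ x.1)).1 ↔ act j false fl (toPt e ((Sigma.map κ (fun _ => id) :
        ((_ : Fin N) × (K →+* ℂ)) → ((_ : Fin 4) × (K →+* ℂ))) x)) ∈ phi :=
    fun x => comp_mem_iff_act_mem_phi κ hΦ hσ x
  rw [Finset.filter_congr fun x _ => key x, Finset.filter_congr fun x _ => (key x).not] at h
  exact h

include he_conj in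
/-- Conjugation is read in the model: `toPt (x̄) = c · toPt x`. [folklore] -/
theorem toPt_conj_smul (x : (_ : Fin 4) × (K →+* ℂ)) :
    toPt e ((starRingAut : ℂ ≃+* ℂ) • x) = act 0 false (true, true, true) (toPt e x) := by
  obtain ⟨b, s⟩ := x
  rw [conj_smul_sigma_eq]
  show toPt e ⟨b, ComplexEmbedding.conjugate s⟩ = act 0 false (true, true, true) (toPt e ⟨b, s⟩)
  rw [toPt_mk, toPt_mk, he_conj, act_conj]

end Transfer

/-! ## §2 Generating parts of a weight of the power have algebraic lines -/

section Parts

variable {K : Type} [Field K] [NumberField K] [IsCMField K] {N : ℕ} (κ : Fin N → Fin 4)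
  {e : (K →+* ℂ) ≃ ZMod 3 × Bool}
  (he_conj : ∀ s : K →+* ℂ, e (ComplexEmbedding.conjugate s) = ((e s).1, !(e s).2))
  {A₄ : Fin 4 → AbelianVariety ℂ} {Φ₄ : Fin 4 → CMType K} {ι₄ : ∀ b : Fin 4, 𝓞 K →+* End (A₄ b)}
  {θ₄ : ∀ b : Fin 4, K →+* Module.End ℂ (complexBetti (A₄ b).X 1)}
  (hA : ∀ b, IsCMTypeRealisation (Φ₄ b) (A₄ b) (ι₄ b) (θ₄ b))
  (hface : ∀ (i : ZMod 3) (sg : Bool) (T : Finset ((_ : Fin 4) × (K →+* ℂ))), T.image (toPt e) = face i sg →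
    weightClassesAlg (K := fun _ : Fin 4 => K) A₄ ι₄ (2 * 2) T ≤ algebraicClasses (⨁ A₄).X 2)

include he_conj hA in
/-- A weight of `Y = ⨁ A₄` whose model image is a conjugate pair is a conjugate pair, so its line is algebraic
(a divisor class). [cite: Gordon1999HodgeAVSurvey, 9.2.2] -/
theorem weightClassesAlg_le_algebraicClasses_of_image_eq_conjPair
    {T : Finset ((_ : Fin 4) × (K →+* ℂ))} {y : Pt} (hT : T.image (toPt e) = conjPair y) :
    T.card = 2 ∧ weightClassesAlg (K := fun _ : Fin 4 => K) A₄ ι₄ (2 * 1) T ≤ algebraicClasses (⨁ A₄).X 1 := by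
  have hinj := toPt_injective e
  have hcard : T.card = 2 := by
    rw [← Finset.card_image_of_injective T hinj, hT, conjPair, Finset.card_pair]
    exact fun h => (isCMType_phi.2.2 y) h.symm
  refine ⟨hcard, weightClassesAlg_le_algebraicClasses_of_conj_smul_mem (K := fun _ : Fin 4 => K) hA (m := 1) hcard
    fun x hx => ?_⟩
  have hx' : toPt e x ∈ conjPair y := hT ▸ Finset.mem_image_of_mem _ hx
  have hcx : toPt e ((starRingAut : ℂ ≃+* ℂ) • x) ∈ T.image (toPt e) := by
    rw [toPt_conj_smul he_conj x, hT, mem_conjPair_iff] at *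
    rcases hx' with h | h
    · exact Or.inr (by rw [h])
    · exact Or.inl (by rw [h, isCMType_phi.2.1])
  exact (hinj.mem_finset_image).1 hcx

include he_conj hA hface in
/-- **A generating part of a weight of `X = ⨁_j A₄ (κ j)` has an algebraic weight line.**  If `v = toPt ∘ P` is
injective on `G` and `v(G)` is `conjPair y` or `face i sg`, then `G` has `2q` elements (`q = 1, 2`) and
`H^{2q}(X)_G ⊆ N^q`: the projected weight `P(G)` of `Y = ⨁ A₄` has the same model image, hence an algebraic line on
`Y` (divisor pair, resp. the hypothesis `hface`), and the distribution lemma lifts it along `κ`.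
[cite: Milne2020HodgeClassesAV, 1.2 (a) and Thm. 1] -/
theorem exists_weightClassesAlg_le_algebraicClasses_of_part {G : Finset ((_ : Fin N) × (K →+* ℂ))}
    (hinj : Set.InjOn (fun x => toPt e ((Sigma.map κ (fun _ => id) :
      ((_ : Fin N) × (K →+* ℂ)) → ((_ : Fin 4) × (K →+* ℂ))) x)) ↑G)
    (hG : G.image (fun x => toPt e ((Sigma.map κ (fun _ => id) :
      ((_ : Fin N) × (K →+* ℂ)) → ((_ : Fin 4) × (K →+* ℂ))) x)) ∈ gens) :
    ∃ q : ℕ, G.card = 2 * q ∧ weightClassesAlg (K := fun _ : Fin N => K) (fun j => A₄ (κ j)) (fun j => ι₄ (κ j))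
      (2 * q) G ≤ algebraicClasses (⨁ fun j => A₄ (κ j)).X q := by
  set P : ((_ : Fin N) × (K →+* ℂ)) → ((_ : Fin 4) × (K →+* ℂ)) := Sigma.map κ (fun _ => id) with hP
  have hPinj : Set.InjOn P ↑G := fun x hx y hy h => hinj hx hy (by simp only [h])
  set TY : Finset ((_ : Fin 4) × (K →+* ℂ)) := G.image P with hTY
  have hTYimg : TY.image (toPt e) = G.image (fun x => toPt e (P x)) := by rw [hTY, Finset.image_image]; rfl
  have hTYcard : TY.card = G.card := Finset.card_image_of_injOn hPinj
  have hGcard_img : G.card = (G.image fun x => toPt e (P x)).card := (Finset.card_image_of_injOn hinj).symm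
  -- the projected weight is algebraic on `Y`, of the right size
  obtain ⟨q, hq, hYalg⟩ : ∃ q, G.card = 2 * q ∧
      weightClassesAlg (K := fun _ : Fin 4 => K) A₄ ι₄ (2 * q) TY ≤ algebraicClasses (⨁ A₄).X q := by
    rcases (mem_gens_iff _).1 hG with ⟨y, hy⟩ | ⟨i, sg, hy⟩
    · obtain ⟨hc, halg⟩ := weightClassesAlg_le_algebraicClasses_of_image_eq_conjPair he_conj hA (T := TY) (y := y)
        (by rw [hTYimg, hy])
      exact ⟨1, by rw [← hTYcard, hc], halg⟩
    · refine ⟨2, ?_, hface i sg TY (by rw [hTYimg, hy])⟩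
      rw [hGcard_img, hy]; exact (gens_balanced.2 i sg).2.1
  -- the distribution lemma lifts it to `X`
  exact ⟨q, hq, weightClassesAlg_comp_le_algebraicClasses_of_injOn (K := fun _ : Fin 4 => K) hA κ hq hPinj hYalg⟩

end Parts

/-! ## §3 Assembly from the face hypothesis -/

section Assembly

variable {K : Type} [Field K] [NumberField K] [IsCMField K] {N : ℕ} (κ : Fin N → Fin 4)
  {e : (K →+* ℂ) ≃ ZMod 3 × Bool}
  {A₄ : Fin 4 → AbelianVariety ℂ} {Φ₄ : Fin 4 → CMType K} {ι₄ : ∀ b : Fin 4, 𝓞 K →+* End (A₄ b)}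
  {θ₄ : ∀ b : Fin 4, K →+* Module.End ℂ (complexBetti (A₄ b).X 1)}

/-- **MAIN THEOREM (frame form).  `HodgeConjectureFor (⨁_j A₄ (κ j))` — the Hodge conjecture for EVERY product of
powers `X₀^a × X₁^b × X₂^c × X₃^d` of the four CM threefolds of a pair-flip sextic CM field — from the frame data and
the algebraicity of the six face weight lines of `Y = X₀ × X₁ × X₂ × X₃` ALONE.**  Every rational `(p,p)`-class of
the power is algebraic: Pohlmann's theorem for the CM algebra `K^N`, frame transfer (§1), the induction principle for
balanced configurations (`Census/PairFlipSexticFourCorePowers.lean`), §2, and the multiplicativity of algebraic weight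
lines. [cite: Pohlmann1968, Thm 1] [cite: GaoUllmo2025, Thm 3.1] [cite: Milne2020HodgeClassesAV, 1.2 (a) and Thm. 1] -/
theorem hodgeConjectureFor_biproduct_comp_of_faces
    (hA : ∀ b, IsCMTypeRealisation (Φ₄ b) (A₄ b) (ι₄ b) (θ₄ b))
    (he_conj : ∀ s : K →+* ℂ, e (ComplexEmbedding.conjugate s) = ((e s).1, !(e s).2))
    (he_gal : ∀ (j : ZMod 3) (fl : Bool × Bool × Bool), ∃ σ : ℂ ≃+* ℂ, ∀ s : K →+* ℂ,
      e ((σ : ℂ →+* ℂ).comp s) = ((e s).1 + j, xor (e s).2 (flipAt fl ((e s).1 + j))))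
    (hΦ : ∀ (b : Fin 4) (s : K →+* ℂ), s ∈ (Φ₄ b).1 ↔ ((b, (e s).1, (e s).2) : Pt) ∈ phi)
    (hface : ∀ (i : ZMod 3) (sg : Bool) (T : Finset ((_ : Fin 4) × (K →+* ℂ))), T.image (toPt e) = face i sg →
      weightClassesAlg (K := fun _ : Fin 4 => K) A₄ ι₄ (2 * 2) T ≤ algebraicClasses (⨁ A₄).X 2) :
    HodgeConjectureFor (⨁ fun j => A₄ (κ j)).dim (⨁ fun j => A₄ (κ j)).X := by
  refine ⟨nonempty_hodgeModel_holds (Motives.AbelianVariety.isSmoothProjective_holds (A := ⨁ fun j => A₄ (κ j))),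
    fun p c hc hH => ?_⟩
  have hAκ : ∀ j, IsCMTypeRealisation (Φ₄ (κ j)) (A₄ (κ j)) (ι₄ (κ j)) (θ₄ (κ j)) := fun j => hA (κ j)
  -- every balanced configuration has algebraic weight lines: induct over its generating parts
  have key : ∀ (R : Finset ((_ : Fin N) × (K →+* ℂ))),
      ModelBalanced (fun x => toPt e ((Sigma.map κ (fun _ => id) :
        ((_ : Fin N) × (K →+* ℂ)) → ((_ : Fin 4) × (K →+* ℂ))) x)) R →
      ∀ q, R.card = 2 * q → weightClassesAlg (K := fun _ : Fin N => K) (fun j => A₄ (κ j)) (fun j => ι₄ (κ j))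
        (2 * q) R ≤ algebraicClasses (⨁ fun j => A₄ (κ j)).X q := by
    intro R hR
    refine modelBalanced_induction (motive := fun R => ∀ q, R.card = 2 * q →
      weightClassesAlg (K := fun _ : Fin N => K) (fun j => A₄ (κ j)) (fun j => ι₄ (κ j)) (2 * q) R ≤
        algebraicClasses (⨁ fun j => A₄ (κ j)).X q)
      (fun q hq => ?_) (fun G R hGR hinj hG ih q hq => ?_) hR
    · obtain rfl : q = 0 := by simpa using hq.symm
      exact fun c _ => hodgeConjectureFor_codim_zero c
    · obtain ⟨a, ha, hGalg⟩ := exists_weightClassesAlg_le_algebraicClasses_of_part κ he_conj hA hface hinj hG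
      have hRcard : R.card = 2 * (q - a) := by
        have h := Finset.card_union_of_disjoint hGR
        rw [hq, ha] at h
        omega
      have haq : a + (q - a) = q := by
        have h := Finset.card_union_of_disjoint hGR
        rw [hq, ha] at h
        omega
      rw [← Finset.disjUnion_eq_union G R hGR]
      exact weightClassesAlg_union_le_algebraicClasses (K := fun _ : Fin N => K) hAκ haq ha hRcard hGR hGalg
        (ih (q - a) hRcard)
  have hmem : c ∈ ⨆ S ∈ pohlmannSetsAlg (K := fun _ : Fin N => K) (fun j => Φ₄ (κ j)) p,
      weightClassesAlg (K := fun _ : Fin N => K) (fun j => A₄ (κ j)) (fun j => ι₄ (κ j)) (2 * p) S := by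
    rw [← (Pohlmann1968_thm1_cmAlgebra (fun _ : Fin N => K) (fun j => A₄ (κ j))
      (fun j => Φ₄ (κ j)) (fun j => ι₄ (κ j)) (fun j => θ₄ (κ j)) hAκ p).1]
    exact Submodule.subset_span ⟨hc, hH⟩
  have hle : (⨆ S ∈ pohlmannSetsAlg (K := fun _ : Fin N => K) (fun j => Φ₄ (κ j)) p,
      weightClassesAlg (K := fun _ : Fin N => K) (fun j => A₄ (κ j)) (fun j => ι₄ (κ j)) (2 * p) S) ≤
      algebraicClasses (⨁ fun j => A₄ (κ j)).X p := by
    refine iSup₂_le fun S hS => ?_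
    exact key S (modelBalanced_of_isGaloisBalancedAlg κ he_gal hΦ hS.2) p hS.1
  exact hle hmem

/-- **The Hodge conjecture for every abelian variety dominated by a power `⨁_j A₄ (κ j)`** (frame form): every
abelian variety isogenous to a product of powers of `X₀, …, X₃` and their abelian subvarieties and quotients, GIVEN the
frame data and the face hypothesis on `X₀ × X₁ × X₂ × X₃`. [cite: Milne2020HodgeClassesAV, Thm. 1] [cite: MumfordAV1970, §19] -/
theorem hodgeConjectureFor_of_avDominatedBy_comp_of_faces
    (hA : ∀ b, IsCMTypeRealisation (Φ₄ b) (A₄ b) (ι₄ b) (θ₄ b))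
    (he_conj : ∀ s : K →+* ℂ, e (ComplexEmbedding.conjugate s) = ((e s).1, !(e s).2))
    (he_gal : ∀ (j : ZMod 3) (fl : Bool × Bool × Bool), ∃ σ : ℂ ≃+* ℂ, ∀ s : K →+* ℂ,
      e ((σ : ℂ →+* ℂ).comp s) = ((e s).1 + j, xor (e s).2 (flipAt fl ((e s).1 + j))))
    (hΦ : ∀ (b : Fin 4) (s : K →+* ℂ), s ∈ (Φ₄ b).1 ↔ ((b, (e s).1, (e s).2) : Pt) ∈ phi)
    (hface : ∀ (i : ZMod 3) (sg : Bool) (T : Finset ((_ : Fin 4) × (K →+* ℂ))), T.image (toPt e) = face i sg →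
      weightClassesAlg (K := fun _ : Fin 4 => K) A₄ ι₄ (2 * 2) T ≤ algebraicClasses (⨁ A₄).X 2)
    {B : AbelianVariety ℂ} (hB : Domination.AVDominatedBy B (⨁ fun j => A₄ (κ j))) :
    HodgeConjectureFor B.dim B.X :=
  Domination.hodgeConjectureFor_of_avDominatedBy
    (hodgeConjectureFor_biproduct_comp_of_faces κ hA he_conj he_gal hΦ hface) hB

/-- **ONE copy of each factor**: `HodgeConjectureFor (⨁ A₄)` — the 12-fold `X₀ × X₁ × X₂ × X₃` itself — from the
frame data and the face hypothesis (`κ = id`). [cite: Pohlmann1968, Thm 1] [cite: GaoUllmo2025, Thm 3.1] -/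
theorem hodgeConjectureFor_biproduct_of_faces
    (hA : ∀ b, IsCMTypeRealisation (Φ₄ b) (A₄ b) (ι₄ b) (θ₄ b))
    (he_conj : ∀ s : K →+* ℂ, e (ComplexEmbedding.conjugate s) = ((e s).1, !(e s).2))
    (he_gal : ∀ (j : ZMod 3) (fl : Bool × Bool × Bool), ∃ σ : ℂ ≃+* ℂ, ∀ s : K →+* ℂ,
      e ((σ : ℂ →+* ℂ).comp s) = ((e s).1 + j, xor (e s).2 (flipAt fl ((e s).1 + j))))
    (hΦ : ∀ (b : Fin 4) (s : K →+* ℂ), s ∈ (Φ₄ b).1 ↔ ((b, (e s).1, (e s).2) : Pt) ∈ phi)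
    (hface : ∀ (i : ZMod 3) (sg : Bool) (T : Finset ((_ : Fin 4) × (K →+* ℂ))), T.image (toPt e) = face i sg →
      weightClassesAlg (K := fun _ : Fin 4 => K) A₄ ι₄ (2 * 2) T ≤ algebraicClasses (⨁ A₄).X 2) :
    HodgeConjectureFor (⨁ A₄).dim (⨁ A₄).X :=
  hodgeConjectureFor_biproduct_comp_of_faces (id : Fin 4 → Fin 4) hA he_conj he_gal hΦ hface

end Assembly

end Summit.HodgeConjecture.CorCM.PairFlipSexticFourCore

end
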